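/-
Copyright: rh-split cell, seat prover-l1 (L1/L19 «DUST WALL»), 2026-08-27.  Plane topology.
Nothing here bears on the truth of RH.
-/
import Summits.RiemannHypothesis.RiemannHypothesis.Theorems.Splittings.ScrewDustZorettiPiece
import Summits.RiemannHypothesis.RiemannHypothesis.Theorems.Splittings.ScrewDustZorettiGrid
import Literature.Topology.PlaneTopology.JordanCurve
import Literature.Probability.RandomPlanarGeometry.RestrictionContinuityProofs
import Mathlib.Topology.Connected.LocallyPathConnected
import HarnessLib

/-!
# Preparations for the Zoretti hull: piece, moat, access path, grid package

Plane-topology pieces for the crux `PointComponentInvisible` (route `ScrewDustWall`, X-11 «DUST WALL»,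
stmt-RiemannHypothesis-21690), feeding `ScrewDustZorettiHull.lean`:

* `exists_piece_and_path`: for a point-component `p` of `W ∩ 𝔻` adherent to the origin's component
  `Ω₀` of `𝔻 ∖ W`, the clopen piece `P ∋ p` with moat `ρ` and connected neighbourhood `N`
  (`exists_clopen_piece`), together with a point `w₀ ∈ Ω₀ ∩ ball p ρ` and a connected compact
  `K ⊆ Ω₀` joining `0` to `w₀` at positive distance from `W` (a path; `Ω₀` is open, hence path connected);
* `exists_grid_package`: the cells, open cells and centres of a uniform grid with their bookkeeping;
* small lemmas: closure points of a component, the connected exterior of a disc, index bounds for cells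
  near a point, and preconnected sets avoiding the unit circle.

No `sorry`, no new axioms, no definitions, no instances, no notation.
-/

set_option linter.dupNamespace false

namespace Summit.RiemannHypothesis.RiemannHypothesis.Theorems.Splittings.ScrewDust

open Complex Filter Topology Set Metric
open Summit.RiemannHypothesis.RiemannHypothesis.Theorems.Splittings.ScrewBorelFlux
open Literature.Topology.PlaneTopology
open Literature.Probability.RandomPlanarGeometry (convex_reProdIm)

/-- Points of the closure of a component of an open set that lie in the open set lie in the component. -/
theorem mem_connectedComponentIn_of_mem_closure {R : Set ℂ} (hR : IsOpen R) {a z : ℂ}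
    (hz : z ∈ closure (connectedComponentIn R a)) (hzR : z ∈ R) : z ∈ connectedComponentIn R a := by
  have hzo : IsOpen (connectedComponentIn R z) := hR.connectedComponentIn
  obtain ⟨w, hwz, hwa⟩ := mem_closure_iff.1 hz _ hzo (mem_connectedComponentIn hzR)
  rw [connectedComponentIn_eq hwa, ← connectedComponentIn_eq hwz]
  exact mem_connectedComponentIn hzR

/-- The exterior `{z | r < dist z p}` of a disc is connected. -/
theorem isConnected_setOf_lt_dist (p : ℂ) {r : ℝ} (hr : 0 ≤ r) : IsConnected {z : ℂ | r < dist z p} := by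
  have e : {z : ℂ | r < dist z p} = (fun z ↦ z + p) '' {z : ℂ | r < ‖z‖} := by
    ext z
    simp only [mem_setOf_eq, mem_image, dist_eq_norm]
    constructor
    · intro h; exact ⟨z - p, h, by ring⟩
    · rintro ⟨w, hw, rfl⟩; simpa using hw
  rw [e]
  exact (isConnected_setOf_lt_norm hr).image _ (continuous_id.add continuous_const).continuousOn

/-- A preconnected set through `0` avoiding the unit circle lies in the unit disc. -/
theorem subset_ball_of_disjoint_sphere {C : Set ℂ} (hC : IsPreconnected C) (h0 : (0 : ℂ) ∈ C)
    (hS : ∀ z ∈ C, z ∉ sphere (0 : ℂ) 1) : C ⊆ ball (0 : ℂ) 1 := by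
  refine hC.subset_left_of_subset_union (v := (closedBall (0 : ℂ) 1)ᶜ) isOpen_ball
    isClosed_closedBall.isOpen_compl ?_ ?_ ⟨0, h0, mem_ball_self one_pos⟩
  · exact Set.disjoint_left.2 fun z hz hz' ↦ hz' (ball_subset_closedBall hz)
  · intro z hz
    have hzS := hS z hz
    rw [mem_sphere_zero_iff_norm] at hzS
    rcases lt_or_gt_of_ne hzS with h | h
    · exact Or.inl (mem_ball_zero_iff.2 h)
    · right
      rw [mem_compl_iff, mem_closedBall_zero_iff, not_le]; exact h

/-- Index bounds: a grid interval `[a + δm, a + δ(m+1)]` containing a point `t` with `|t - q| ≤ e` has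
`⌊(q - e - a)/δ⌋ - 1 ≤ m ≤ ⌈(q + e - a)/δ⌉`. -/
theorem floor_ceil_bounds {a t q δ e : ℝ} (hδ : 0 < δ) {m : ℤ} (h1 : a + δ * m ≤ t)
    (h2 : t ≤ a + δ * (m + 1)) (h3 : -e ≤ t - q) (h4 : t - q ≤ e) :
    ⌊(q - e - a) / δ⌋ - 1 ≤ m ∧ m ≤ ⌈(q + e - a) / δ⌉ := by
  constructor
  · have h5 : (q - e - a) / δ ≤ (m : ℝ) + 1 := by
      rw [div_le_iff₀ hδ]; linarith
    have h6 : ⌊(q - e - a) / δ⌋ ≤ m + 1 := Int.floor_le_iff.2 (by push_cast; linarith)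
    omega
  · have h5 : (m : ℝ) ≤ (q + e - a) / δ := by
      rw [le_div_iff₀ hδ]; linarith
    exact Int.cast_le.1 (h5.trans (Int.le_ceil _))

/-- Cells of a uniform grid meeting the closed `e`-box around `q` have indices in an explicit finite box. -/
theorem mem_box_of_mem_cell {x y : ℤ → ℝ} {a₁ a₂ δ : ℝ} (hx : ∀ m, x m = a₁ + δ * m)
    (hy : ∀ n, y n = a₂ + δ * n) (hδ : 0 < δ) {q z : ℂ} {e : ℝ} {k : ℤ × ℤ}
    (hz : z ∈ Icc (x k.1) (x (k.1 + 1)) ×ℂ Icc (y k.2) (y (k.2 + 1))) (hzq : dist z q ≤ e) :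
    k ∈ (Finset.Icc (⌊(q.re - e - a₁) / δ⌋ - 1) ⌈(q.re + e - a₁) / δ⌉) ×ˢ
      (Finset.Icc (⌊(q.im - e - a₂) / δ⌋ - 1) ⌈(q.im + e - a₂) / δ⌉) := by
  have hzn : ‖z - q‖ ≤ e := by rwa [dist_eq_norm] at hzq
  have hre : |z.re - q.re| ≤ e := by
    have := abs_re_le_norm (z - q); rw [sub_re] at this; exact this.trans hzn
  have him : |z.im - q.im| ≤ e := by
    have := abs_im_le_norm (z - q); rw [sub_im] at this; exact this.trans hzn
  rw [abs_le] at hre him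
  rw [mem_reProdIm, mem_Icc, mem_Icc, hx, hx, hy, hy] at hz
  push_cast at hz
  rw [Finset.mem_product, Finset.mem_Icc, Finset.mem_Icc]
  have k1 := floor_ceil_bounds hδ hz.1.1 hz.1.2 hre.1 hre.2
  have k2 := floor_ceil_bounds hδ hz.2.1 hz.2.2 him.1 him.2
  exact ⟨⟨k1.1, k1.2⟩, k2.1, k2.2⟩

/-- **Piece, moat, neighbourhood and access path.**  See the module docstring. -/
theorem exists_piece_and_path {W : Set ℂ} (hW : IsClosed W) (h0W : (0 : ℂ) ∉ W) {p : ℂ}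
    (hpW : p ∈ W) (hcomp : connectedComponentIn (W ∩ ball (0 : ℂ) 1) p ⊆ {p})
    (hadh : p ∈ closure (connectedComponentIn (ball (0 : ℂ) 1 \ W) 0)) {ε' : ℝ}
    (hε'0 : 0 < ε') (hε'1 : ε' < 1 - ‖p‖) :
    ∃ (P N K : Set ℂ) (ρ d₀ : ℝ) (w₀ : ℂ), 0 < ρ ∧ ρ ≤ ε' / 4 ∧ P ⊆ W ∧ p ∈ P ∧
      P ⊆ ball p (ε' / 4) ∧ IsClosed (W \ P) ∧ (∀ w ∈ P, ∀ z ∈ W \ P, ρ ≤ dist w z) ∧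
      IsPreconnected N ∧ N ⊆ ball p ε' ∧ N ∩ W ⊆ P ∧ (∀ w ∈ P, ball w ρ ⊆ N) ∧
      w₀ ∈ ball p ρ ∧ 0 < d₀ ∧ IsPreconnected K ∧ (0 : ℂ) ∈ K ∧ w₀ ∈ K ∧
      K ⊆ connectedComponentIn (ball (0 : ℂ) 1 \ W) 0 ∧ (∀ z ∈ K, ∀ q ∈ W, d₀ ≤ ‖q - z‖) := by
  obtain ⟨P, N, ρ, hρ0, hρε, -, hPW, hpP, hPε, hWP, hgap, -, hNc, -, hNε, hNW, hballN⟩ :=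
    exists_clopen_piece hW hpW hcomp hε'0 hε'1
  set Ω₀ : Set ℂ := connectedComponentIn (ball (0 : ℂ) 1 \ W) 0 with hΩ₀
  have hΩo : IsOpen Ω₀ := (isOpen_ball.sdiff hW).connectedComponentIn
  have h0Ω : (0 : ℂ) ∈ Ω₀ := mem_connectedComponentIn ⟨mem_ball_self one_pos, h0W⟩
  have hΩsub : Ω₀ ⊆ ball 0 1 \ W := connectedComponentIn_subset _ _
  obtain ⟨w₀, hw₀B, hw₀Ω⟩ : ∃ w₀ ∈ ball p ρ, w₀ ∈ Ω₀ := by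
    obtain ⟨w, hw⟩ := mem_closure_iff.1 hadh (ball p ρ) isOpen_ball (mem_ball_self hρ0)
    exact ⟨w, hw.1, hw.2⟩
  have hΩpc : IsPathConnected Ω₀ :=
    (hΩo.isConnected_iff_isPathConnected).1 ⟨⟨0, h0Ω⟩, isPreconnected_connectedComponentIn⟩
  have hJ : JoinedIn Ω₀ 0 w₀ := hΩpc.joinedIn 0 h0Ω w₀ hw₀Ω
  set γ : Path (0 : ℂ) w₀ := hJ.somePath with hγdef
  have hγΩ : ∀ t, γ t ∈ Ω₀ := hJ.somePath_mem
  have hKc : IsCompact (range γ) := isCompact_range γ.continuous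
  have hKdisj : Disjoint (range γ) (closure W) := by
    rw [hW.closure_eq]
    exact Set.disjoint_left.2 (by rintro _ ⟨t, rfl⟩ hW'; exact (hΩsub (hγΩ t)).2 hW')
  obtain ⟨d₀, hd₀, hsep₀⟩ := exists_separation hKc hKdisj
  exact ⟨P, N, range γ, ρ, d₀, w₀, hρ0, hρε, hPW, hpP, hPε, hWP, hgap, hNc, hNε, hNW, hballN, hw₀B,
    hd₀, isPreconnected_range γ.continuous, ⟨0, γ.source⟩, ⟨1, γ.target⟩,
    by rintro _ ⟨t, rfl⟩; exact hγΩ t, hsep₀⟩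

/-- **Grid package.**  The closed cells, open cells and centres of the uniform grid
`x m = a₁ + δ m`, `y n = a₂ + δ n` as functions of the cell index, with their bookkeeping. -/
theorem exists_grid_package {x y : ℤ → ℝ} {a₁ a₂ δ : ℝ} (hx : ∀ m, x m = a₁ + δ * m)
    (hy : ∀ n, y n = a₂ + δ * n) (hδ : 0 < δ) :
    ∃ (cell cello : ℤ × ℤ → Set ℂ) (ctr : ℤ × ℤ → ℂ),
      (∀ k, cell k = Icc (x k.1) (x (k.1 + 1)) ×ℂ Icc (y k.2) (y (k.2 + 1))) ∧
      (∀ k, cello k = Ioo (x k.1) (x (k.1 + 1)) ×ℂ Ioo (y k.2) (y (k.2 + 1))) ∧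
      (∀ k, cello k ⊆ cell k) ∧ (∀ k, ctr k ∈ cello k) ∧ (∀ k, ctr k ∈ cell k) ∧
      (∀ k, ∀ v ∈ cell k, ∀ w ∈ cell k, dist v w ≤ 2 * δ) ∧
      (∀ k, IsPreconnected (cell k)) ∧ (∀ k, IsPreconnected (cello k)) ∧
      (∀ v : ℂ, v ∈ cell (⌊(v.re - a₁) / δ⌋, ⌊(v.im - a₂) / δ⌋)) ∧
      (∀ v : ℂ, ∀ k j : ℤ × ℤ, v ∈ cello k → v ∈ cell j → j = k) ∧
      (∀ k, cell k ⊆ closure (cello k)) := by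
  refine ⟨fun k ↦ Icc (x k.1) (x (k.1 + 1)) ×ℂ Icc (y k.2) (y (k.2 + 1)),
    fun k ↦ Ioo (x k.1) (x (k.1 + 1)) ×ℂ Ioo (y k.2) (y (k.2 + 1)),
    fun k ↦ ((x k.1 + δ / 2 : ℝ) : ℂ) + ((y k.2 + δ / 2 : ℝ) : ℂ) * I,
    fun k ↦ rfl, fun k ↦ rfl, fun k ↦ cello_subset_cell x y k, fun k ↦ center_mem_cello hx hy hδ k,
    fun k ↦ cello_subset_cell x y k (center_mem_cello hx hy hδ k),
    fun k v hv w hw ↦ dist_le_of_mem_cell hx hy hv hw,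
    fun k ↦ (convex_reProdIm (convex_Icc _ _) (convex_Icc _ _)).isPreconnected,
    fun k ↦ (convex_reProdIm (convex_Ioo _ _) (convex_Ioo _ _)).isPreconnected,
    fun v ↦ mem_cell_floor hx hy hδ v,
    fun v k j hv hj ↦ eq_of_mem_cello_of_mem_cell hx hy hδ hv hj,
    fun k ↦ cell_subset_closure_cello hx hy hδ k⟩

end Summit.RiemannHypothesis.RiemannHypothesis.Theorems.Splittings.ScrewDust
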